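import Mathlib
import HarnessLib
import Summits.HubbardSuperconductivity.HubbardSuperconductivity.Theorems.KLProgrammeKLRegimeEngineLastStepTwoLegReadOfPosC2
import Summits.HubbardSuperconductivity.HubbardSuperconductivity.Theorems.KLProgrammeKLRegimeFlowReadTransportOneCallL2
import Summits.HubbardSuperconductivity.HubbardSuperconductivity.Theorems.KLProgrammeKLRegimeCountertermJacksonRemainderCertAnFitKlEng
import Summits.HubbardSuperconductivity.HubbardSuperconductivity.Theorems.KLProgrammeKLRegimeCountertermJacksonRemainderReadResidueC1TabFitA
import Summits.HubbardSuperconductivity.HubbardSuperconductivity.Theorems.KLProgrammeKLRegimeSplitGenericV3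

/-!
# K3 gen-8-FLOW (stmt 20437, stub (C), located item #20 (δ′)): «LAST-ALL-DOORS», L2 — the last-index registered pair with (R), (T), (C1) by name, the (T) rows on
# the U-AWARE table (cell gate-hubbard-kl, seat p2 g23)

L2 twins of `twoLegRead_flow_last_registered_of_pos_c2` (…LastStepTwoLegReadOfPosC2) and of `twoLegRead_flow_last_registered_deep/_table`
(…LastStepTwoLegReadAllDoors): the primed (T) table `eT′` only has to dominate the L2 table of `transport_last_flow_fit_of_spaceMoments_l2` (located «(C2)-L-DEGREE»
cured); `2(Gfr₃+Gfr₄)U² ≤ 1` is a hypothesis of the `_c2_l2` form (curve-regime binders) and DISCHARGED in the stub-binder forms (`Gfr_j·U ≤ 2⁻¹²⁷`).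
* **`twoLegRead_flow_last_registered_of_pos_c2_l2`**, **`twoLegRead_flow_last_registered_deep_l2`** (`5 ≤ n_β`), **`twoLegRead_flow_last_registered_table_l2`**
  (`n_β + 1 ≤ 21`).
Compositions only; no definitions; nothing asserts any stub of 20437, K3, the margin or superconductivity.  References: BGM 2006 §2.4 Lemma 2.1 (2.36)–(2.42)
[cite: BenfattoGiulianiMastropietro2006]; FST 1996 §1 [cite: FeldmanSalmhoferTrubowitz1996].
-/

noncomputable section

namespace Summit.HubbardSuperconductivity.HubbardSuperconductivity.Theorems.EngineV8

set_option linter.dupNamespace false -- summit = problem name (single-conjunct summit), D-0017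
set_option exponentiation.threshold 1024 -- `2^200`/`2^282` literals in the budget expressions

open Complex Real Finset Filter Literature.MathematicalPhysics.QuantumLattice Literature.Probability.LatticeModels GrassmannAlgebra
open Literature.MathematicalPhysics.QuantumLattice.BandSectorCounting Literature.MathematicalPhysics.QuantumLattice.FermiRG
open Literature.Analysis.Fourier Literature.Analysis.Calculus
open Summit.HubbardSuperconductivity.HubbardSuperconductivity.Theorems.KLRegimeSplit
open Summit.HubbardSuperconductivity.HubbardSuperconductivity.Theorems.DispersionFlow
open Summit.HubbardSuperconductivity.HubbardSuperconductivity.Theorems.KLProgrammeLegKernels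
open Summit.HubbardSuperconductivity.HubbardSuperconductivity.Theorems.PerturbedFermiCurve
open scoped Nat

variable {L M : ℕ} [NeZero L] [NeZero M]

/-- **L2 TWIN** of `twoLegRead_flow_last_registered_of_pos_c2`: (R) and (T) discharged by name, the (T) rows on the U-AWARE table of
`transport_last_flow_fit_of_spaceMoments_l2` (hypothesis `2(Gfr₃+Gfr₄)U² ≤ 1`).
[cite: BenfattoGiulianiMastropietro2006, §2.4 Lemma 2.1 (2.36)–(2.42)] -/
theorem twoLegRead_flow_last_registered_of_pos_c2_l2 {R : RenConsts} (hR : ∀ j, 0 ≤ R.Gfr j) {c : ℝ} (hc : 0 < c) (hcle : c ≤ klCurveC3 R)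
    {U : ℝ} (hU : 0 < U) (hU1 : U ≤ 1) (hUle : U ≤ klCurveU0 R)
    (hG34U : 2 * (R.Gfr 3 + R.Gfr 4) * U ^ 2 ≤ 1) {β : ℝ} (hβmin : klBetaMin ≤ β) (hβc : β ≤ Real.exp (c / U ^ 2))
    {μ : ℝ} (hμ : μ ∈ klWindowC) (hK : FrameOK R U (nScales β) μ (klFlowFrameU L M β U μ (nScales β)))
    (hK1 : FrameOK R U (nScales β) μ (klFlowFrameU L M β U μ (nScales β + 1))) {G : GeoConsts} {Q : EngConsts} (hGS : ∀ k, 0 ≤ G.S k) (hQS : ∀ k, 0 ≤ Q.S' k) (hR0 : 0 < R.Gfr 0)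
    (hPh : ∀ m ≤ nScales β, FlowPieceJetsAt L M β U μ R m) (hT : ∀ m ≤ nScales β, TwoLegReadJetsF L M G Q β U μ m) {W Ξ Θ : ℝ}
    (hW : W = curveExtC (klChi2CauchyTab2 4) G.S 1 + curveExtC (klChi2CauchyTab2 4) Q.S' 1 * |U|) (hΞ : Ξ = 2 ^ 10 * (1 + Real.pi ^ 8 * (W * U ^ 2) / 2 ^ 11) + ∑ j ∈ range 5, R.Gfr j)
    (hΘ : Θ = 1 + ((∑ j ∈ range 5, R.Gfr j) + Real.pi ^ 8 * W / 2 ^ 11) * |U| / R.Gfr 0)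
    (hdoor : R.Gfr 0 * |U| + ((∑ j ∈ range 5, R.Gfr j) + Real.pi ^ 8 * W / 2 ^ 11) * U ^ 2 ≤ 1 / 512) {P : SplitConsts} (hL : klEngL₄ P R β U ≤ L)
    (hZn : IsUnit (effPartitionFn ℂ (normalCovariance L M (uvSymbolCT L M β μ (klFlowFrameU L M β U μ (nScales β + 1)) (klScale klE0 (nScales β + 1))))
      (hubbardInteraction L M β U + counterQuadratic L M β (klFlowFrameU L M β U μ (nScales β + 1)))))
    {s : ℕ} (hs : 10 ≤ s)
    {cb cbs cc ccs : ℝ} (hcb : 0 ≤ cb) (hcbs : 0 ≤ cbs) (hcc : 0 ≤ cc) (hccs : 0 ≤ ccs)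
    (hSb : ∀ m ≤ 4, ∀ (σ : Fin 2) (x₀ : SpaceTimeIdx L M), imagTimeWeight β M *
      ∑ x ∈ (univ : Finset (Fin 2 → SpaceTimeIdx L M)).filter (fun x => x 0 = x₀),
        (1 + ((((x 1).2 - (x 0).2) 0).valMinAbs.natAbs : ℝ) + ((((x 1).2 - (x 0).2) 1).valMinAbs.natAbs : ℝ)) ^ m *
          ‖sectorisedKernel L M β (trivialMultiplier L M) (klEffectiveAction L M β U μ (klFlowFrameU L M β U μ (nScales β + 1)) klE0 (nScales β + 1)) 2
            (![((0, σ), 0), ((0, σ), 1)] : Fin 2 → SectorLeg 1) x‖ ≤ cb * U * ((4 : ℝ) ^ nScales β) ^ m)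
    (hSbs : ∀ (σ : Fin 2) (x₀ : SpaceTimeIdx L M), imagTimeWeight β M *
      ∑ x ∈ (univ : Finset (Fin 2 → SpaceTimeIdx L M)).filter (fun x => x 0 = x₀),
        (1 + ((((x 1).2 - (x 0).2) 0).valMinAbs.natAbs : ℝ) + ((((x 1).2 - (x 0).2) 1).valMinAbs.natAbs : ℝ)) ^ s *
          ‖sectorisedKernel L M β (trivialMultiplier L M) (klEffectiveAction L M β U μ (klFlowFrameU L M β U μ (nScales β + 1)) klE0 (nScales β + 1)) 2
            (![((0, σ), 0), ((0, σ), 1)] : Fin 2 → SectorLeg 1) x‖ ≤ cbs * U * ((4 : ℝ) ^ nScales β) ^ s)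
    (hTc : ∀ m ≤ 4, ∀ (σ : Fin 2) (x₀ : SpaceTimeIdx L M), imagTimeWeight β M *
      ∑ x ∈ (univ : Finset (Fin 2 → SpaceTimeIdx L M)).filter (fun x => x 0 = x₀),
        (1 + ((((x 1).2 - (x 0).2) 0).valMinAbs.natAbs : ℝ) + ((((x 1).2 - (x 0).2) 1).valMinAbs.natAbs : ℝ)) ^ m * (imagTimeWeight β M * (circDist (2 * M) (x 0).1.val (x 1).1.val : ℝ)) *
          ‖sectorisedKernel L M β (trivialMultiplier L M) (klEffectiveAction L M β U μ (klFlowFrameU L M β U μ (nScales β + 1)) klE0 (nScales β + 1)) 2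
            (![((0, σ), 0), ((0, σ), 1)] : Fin 2 → SectorLeg 1) x‖ ≤ cc * U ^ 2 * ((4 : ℝ) ^ nScales β) ^ m)
    (hTcs : ∀ (σ : Fin 2) (x₀ : SpaceTimeIdx L M), imagTimeWeight β M *
      ∑ x ∈ (univ : Finset (Fin 2 → SpaceTimeIdx L M)).filter (fun x => x 0 = x₀),
        (1 + ((((x 1).2 - (x 0).2) 0).valMinAbs.natAbs : ℝ) + ((((x 1).2 - (x 0).2) 1).valMinAbs.natAbs : ℝ)) ^ s * (imagTimeWeight β M * (circDist (2 * M) (x 0).1.val (x 1).1.val : ℝ)) *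
          ‖sectorisedKernel L M β (trivialMultiplier L M) (klEffectiveAction L M β U μ (klFlowFrameU L M β U μ (nScales β + 1)) klE0 (nScales β + 1)) 2
            (![((0, σ), 0), ((0, σ), 1)] : Fin 2 → SectorLeg 1) x‖ ≤ ccs * U ^ 2 * ((4 : ℝ) ^ nScales β) ^ s)
    (hUlast : U ≤ klLastRespU P R) (hUE1 : 32 * klEngRsq R ^ 5 * (2 ^ 234 * cb + 2 ^ 156 * cc + cbs + ccs) * U ≤ 1)
    -- the (P)-receiver's other inputs at the last index (k3c3-p1 `twoLegRead_flow_succ_of_swap_lit_registered`, n := n_β)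
    (hLdeg : 4 * klFlowDeg (nScales β + 1) ≤ L) {cA cA' eJ eJ' : ℕ → ℝ} {τA a : ℝ}
    (hA : TwoLegCurveJetBound L M cA cA' β U μ (klFlowFrameU L M β U μ (nScales β)) (nScales β + 1))
    (hAval : ∀ θ : ℝ, |klTwoLegCurveProfile L M β U μ (klFlowFrameU L M β U μ (nScales β)) (nScales β + 1) θ - τA| ≤
      a * U ^ 2 * (4 : ℝ) ^ (-2 * ((nScales β + 1 : ℕ) : ℤ)))
    -- (T): the #17 export at the LAST index `(K_{n_β+1}, n_β+1)`, five rows (factor `4^{j−1}`), a primed table above `transport_jets_flow_fit`'s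
    {z : ℕ → ℝ} (hz : ∀ j, 0 ≤ z j) (hZsp : TwoLegDualSpaceMomentsUpToAt L M (klZspLaw z U (nScales β + 1)) β U μ (nScales β + 1) 5)
    {mT : ℕ → ℝ} (hmT : ∀ j, 0 ≤ mT j)
    (hmT1 : 4 / 3 * R.Gfr 1 + 2 * z 1 ≤ mT 1) (hmT2 : R.Gfr 2 + 8 * z 2 ≤ mT 2) (hmT3 : R.Gfr 3 / 3 + 32 * z 3 ≤ mT 3)
    (hmT4 : R.Gfr 4 / 15 + 128 * z 4 ≤ mT 4) (hmT5 : 2 ^ 5 * (Real.pi ^ 8 / 4 * 2 ^ 4 * (2 : ℝ) ^ 32) * W / 63 + 512 * z 5 ≤ mT 5)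
    {eT' : ℕ → ℝ} (heT : ∀ k ≤ 4,
        (fun k : ℕ =>
          if k = 0 then 16 * ((12.2 * R.Gfr 0 * mT 1))
          else if k = 1 then 4 * ((1420 * 2 * (R.Gfr 1 + R.Gfr 2 + R.Gfr 3 + R.Gfr 4) * 2 * mT 1) + (36400 * R.Gfr 0 * mT 1) + (2820 * R.Gfr 0 * mT 2))
          else if k = 2 then ((12900000 * 2 ^ 2 * (R.Gfr 1 + R.Gfr 2 + R.Gfr 3 + R.Gfr 4) * 2 ^ 2 * mT 1) + (657000 * 2 * (R.Gfr 1 + R.Gfr 2 + R.Gfr 3 + R.Gfr 4) * 2 * mT 2) + (338000000 * 2 * R.Gfr 0 * 2 * mT 1) + (25400000 * R.Gfr 0 * mT 2) + (652000 * R.Gfr 0 * mT 3))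
          else if k = 3 then ((199000000000 * 2 ^ 3 * (R.Gfr 1 + R.Gfr 2 + R.Gfr 3 + R.Gfr 4) * 2 ^ 3 * mT 1) + (12000000000 * 2 ^ 2 * (R.Gfr 1 + R.Gfr 2 + R.Gfr 3 + R.Gfr 4) * 2 ^ 2 * mT 2) + (228000000 * 2 * (R.Gfr 1 + R.Gfr 2 + R.Gfr 3 + R.Gfr 4) * 2 * mT 3) + (5230000000000 * 2 ^ 2 * R.Gfr 0 * 2 ^ 2 * mT 1) + (392000000000 * 2 * R.Gfr 0 * 2 * mT 2) + (11800000000 * R.Gfr 0 * mT 3) + (151000000 * R.Gfr 0 * mT 4)) / 4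
          else if k = 4 then ((4300000000000000 * 2 ^ 4 * (R.Gfr 1 + R.Gfr 2 + R.Gfr 3 + R.Gfr 4) * 2 ^ 4 * mT 1) + (276000000000000 * 2 ^ 3 * (R.Gfr 1 + R.Gfr 2 + R.Gfr 3 + R.Gfr 4) * 2 ^ 3 * mT 2) + (6890000000000 * 2 ^ 2 * (R.Gfr 1 + R.Gfr 2 + R.Gfr 3 + R.Gfr 4) * 2 ^ 2 * mT 3) + (70100000000 * 2 * (R.Gfr 1 + R.Gfr 2 + R.Gfr 3 + R.Gfr 4) * 2 * mT 4) + (114000000000000000 * 2 ^ 2 * R.Gfr 0 * 2 ^ 2 * mT 1) + (8490000000000000 * 2 ^ 2 * R.Gfr 0 * 2 ^ 2 * mT 2) + (272000000000000 * 2 * R.Gfr 0 * 2 * mT 3) + (4530000000000 * R.Gfr 0 * mT 4) + (34800000000 * R.Gfr 0 * mT 5) + (69200000000 * (16 / 15) * R.Gfr 4 * mT 1)) / 16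
          else 0) k ≤ eT' k)
    (hJdiff : ContDiff ℝ 4 fun θ : ℝ => klLocalPart L M β U μ (klFlowFrameU L M β U μ (nScales β)) (nScales β) θ -
      (klFlowPiece L M β U μ (nScales β)).eval (klFermiPoint μ (klFlowFrameU L M β U μ (nScales β + 1)) θ))
    (hJ : ∀ k ≤ 4, ∀ θ : ℝ, |iteratedDeriv k (fun θ : ℝ => klLocalPart L M β U μ (klFlowFrameU L M β U μ (nScales β)) (nScales β) θ -
      (klFlowPiece L M β U μ (nScales β)).eval (klFermiPoint μ (klFlowFrameU L M β U μ (nScales β + 1)) θ)) θ| ≤ curveJetBar eJ eJ' U k (nScales β + 1))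
    (heJ0 : eJ 0 = 0)
    (hfit : ∀ k, cA k + ((if k = 0 then (0 : ℝ) else 1) + eJ k) ≤ klC4aJetC2 k)
    (hfit' : ∀ k, cA' k + ((if k = 0 then (1 : ℝ) else 0) + eT' k + eJ' k) ≤ klC4aJetC' P R k)
    (hfitO : 2 * (a + (1 + eT' 0 + eJ' 0)) ≤ klReadOscC P R) :
    TwoLegReadJetBound L M klC4aJetC2 (klC4aJetC' P R) β U μ (klFlowFrameU L M β U μ (nScales β + 1)) (nScales β + 1) ∧
      TwoLegReadOscAt L M (klReadOscC P R) β U μ (klFlowFrameU L M β U μ (nScales β + 1)) (nScales β + 1) := by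
  obtain ⟨hTrdiff, hTr0⟩ := transport_last_flow_fit_of_spaceMoments_l2 (L := L) (M := M) hR hGS hQS hc hcle hU hUle hG34U hβmin hβc hμ le_rfl hK hK1
    (salmhoferCutoff_flat_cauchy_table2 4) hPh hT le_rfl hLdeg hmT hz hZsp hmT1 hmT2 hmT3 hmT4 (by rw [hW] at hmT5; exact hmT5)
  have hTr := fun k (hk : k ≤ 4) θ => (hTr0 k hk θ).trans (curveJetBar_zero_mono_snd_at (U := U) (n := nScales β + 1) (heT k hk))
  have hfit2 : ∀ k, cA k + ((if k = 0 then (0 : ℝ) else 1) + (fun _ : ℕ => (0 : ℝ)) k + eJ k) ≤ klC4aJetC2 k := fun k => by simpa using hfit k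
  exact twoLegRead_flow_last_registered_of_pos hR hc hcle hU hU1 hUle hβmin hβc hμ hK hGS hQS hR0 hPh hT hW hΞ hΘ hdoor hL hZn hs hcb hcbs hcc hccs hSb hSbs
    hTc hTcs hUlast hUE1 hLdeg hA hAval hTrdiff hTr hJdiff hJ rfl heJ0 hfit2 hfit' hfitO

/-- **«LAST-ALL-DOORS», deep** (`5 ≤ n_β`): stub (C) v2's REGISTERED pair at `(K_{n_β+1}, n_β+1)` with (R), (T) AND (C1) discharged by name, (T) on the U-AWARE (L2) table — (C1) :=
k3c3-p3's analytic branch at `n := n_β` keyed on the PRIVATE induction hypothesis `TwoLegReadJetBound L M pc pc′ … K_{n_β} n_β` (matrix `klC1AnFit`).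
Left: (A)-OLD-FRAME `hA/hAval` (c4a-1), E1's `cb cbs cc ccs`/`z`, rows, `eT′`, certificate `KlwjCertA`, the three fits.
[cite: BenfattoGiulianiMastropietro2006, §2.4 Lemma 2.1 (2.36)–(2.42)] -/
theorem twoLegRead_flow_last_registered_deep_l2 {P : SplitConsts} {R : RenConsts} (hRW : R.WF) {c : ℝ} (hc : 0 < c) (hc6 : c ≤ klEngC₃6 P R)
    {U : ℝ} (hU : 0 < U) (hU9 : U ≤ klEngU₀9 P R c) {β : ℝ} (hβmin : klBetaMin ≤ β) (hβc : β ≤ Real.exp (c / U ^ 2)) (hN5 : 5 ≤ nScales β)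
    {μ : ℝ} (hμ : μ ∈ klWindowC) (hK : FrameOK R U (nScales β) μ (klFlowFrameU L M β U μ (nScales β)))
    (hK1 : FrameOK R U (nScales β) μ (klFlowFrameU L M β U μ (nScales β + 1))) {G : GeoConsts} {Q : EngConsts} (hGS : ∀ k, 0 ≤ G.S k) (hQS : ∀ k, 0 ≤ Q.S' k) (hR0 : 0 < R.Gfr 0)
    (hPh : ∀ m ≤ nScales β, FlowPieceJetsAt L M β U μ R m) (hT : ∀ m ≤ nScales β, TwoLegReadJetsF L M G Q β U μ m) {W Ξ Θ : ℝ}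
    (hW : W = curveExtC (klChi2CauchyTab2 4) G.S 1 + curveExtC (klChi2CauchyTab2 4) Q.S' 1 * |U|) (hΞ : Ξ = 2 ^ 10 * (1 + Real.pi ^ 8 * (W * U ^ 2) / 2 ^ 11) + ∑ j ∈ range 5, R.Gfr j)
    (hΘ : Θ = 1 + ((∑ j ∈ range 5, R.Gfr j) + Real.pi ^ 8 * W / 2 ^ 11) * |U| / R.Gfr 0)
    (hdoor : R.Gfr 0 * |U| + ((∑ j ∈ range 5, R.Gfr j) + Real.pi ^ 8 * W / 2 ^ 11) * U ^ 2 ≤ 1 / 512) (hL : klEngL₄ P R β U ≤ L)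
    (hZn : IsUnit (effPartitionFn ℂ (normalCovariance L M (uvSymbolCT L M β μ (klFlowFrameU L M β U μ (nScales β + 1)) (klScale klE0 (nScales β + 1))))
      (hubbardInteraction L M β U + counterQuadratic L M β (klFlowFrameU L M β U μ (nScales β + 1)))))
    {s : ℕ} (hs : 10 ≤ s)
    {cb cbs cc ccs : ℝ} (hcb : 0 ≤ cb) (hcbs : 0 ≤ cbs) (hcc : 0 ≤ cc) (hccs : 0 ≤ ccs)
    (hSb : ∀ m ≤ 4, ∀ (σ : Fin 2) (x₀ : SpaceTimeIdx L M), imagTimeWeight β M *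
      ∑ x ∈ (univ : Finset (Fin 2 → SpaceTimeIdx L M)).filter (fun x => x 0 = x₀),
        (1 + ((((x 1).2 - (x 0).2) 0).valMinAbs.natAbs : ℝ) + ((((x 1).2 - (x 0).2) 1).valMinAbs.natAbs : ℝ)) ^ m *
          ‖sectorisedKernel L M β (trivialMultiplier L M) (klEffectiveAction L M β U μ (klFlowFrameU L M β U μ (nScales β + 1)) klE0 (nScales β + 1)) 2
            (![((0, σ), 0), ((0, σ), 1)] : Fin 2 → SectorLeg 1) x‖ ≤ cb * U * ((4 : ℝ) ^ nScales β) ^ m)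
    (hSbs : ∀ (σ : Fin 2) (x₀ : SpaceTimeIdx L M), imagTimeWeight β M *
      ∑ x ∈ (univ : Finset (Fin 2 → SpaceTimeIdx L M)).filter (fun x => x 0 = x₀),
        (1 + ((((x 1).2 - (x 0).2) 0).valMinAbs.natAbs : ℝ) + ((((x 1).2 - (x 0).2) 1).valMinAbs.natAbs : ℝ)) ^ s *
          ‖sectorisedKernel L M β (trivialMultiplier L M) (klEffectiveAction L M β U μ (klFlowFrameU L M β U μ (nScales β + 1)) klE0 (nScales β + 1)) 2
            (![((0, σ), 0), ((0, σ), 1)] : Fin 2 → SectorLeg 1) x‖ ≤ cbs * U * ((4 : ℝ) ^ nScales β) ^ s)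
    (hTc : ∀ m ≤ 4, ∀ (σ : Fin 2) (x₀ : SpaceTimeIdx L M), imagTimeWeight β M *
      ∑ x ∈ (univ : Finset (Fin 2 → SpaceTimeIdx L M)).filter (fun x => x 0 = x₀),
        (1 + ((((x 1).2 - (x 0).2) 0).valMinAbs.natAbs : ℝ) + ((((x 1).2 - (x 0).2) 1).valMinAbs.natAbs : ℝ)) ^ m * (imagTimeWeight β M * (circDist (2 * M) (x 0).1.val (x 1).1.val : ℝ)) *
          ‖sectorisedKernel L M β (trivialMultiplier L M) (klEffectiveAction L M β U μ (klFlowFrameU L M β U μ (nScales β + 1)) klE0 (nScales β + 1)) 2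
            (![((0, σ), 0), ((0, σ), 1)] : Fin 2 → SectorLeg 1) x‖ ≤ cc * U ^ 2 * ((4 : ℝ) ^ nScales β) ^ m)
    (hTcs : ∀ (σ : Fin 2) (x₀ : SpaceTimeIdx L M), imagTimeWeight β M *
      ∑ x ∈ (univ : Finset (Fin 2 → SpaceTimeIdx L M)).filter (fun x => x 0 = x₀),
        (1 + ((((x 1).2 - (x 0).2) 0).valMinAbs.natAbs : ℝ) + ((((x 1).2 - (x 0).2) 1).valMinAbs.natAbs : ℝ)) ^ s * (imagTimeWeight β M * (circDist (2 * M) (x 0).1.val (x 1).1.val : ℝ)) *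
          ‖sectorisedKernel L M β (trivialMultiplier L M) (klEffectiveAction L M β U μ (klFlowFrameU L M β U μ (nScales β + 1)) klE0 (nScales β + 1)) 2
            (![((0, σ), 0), ((0, σ), 1)] : Fin 2 → SectorLeg 1) x‖ ≤ ccs * U ^ 2 * ((4 : ℝ) ^ nScales β) ^ s)
    (hUlast : U ≤ klLastRespU P R) (hUE1 : 32 * klEngRsq R ^ 5 * (2 ^ 234 * cb + 2 ^ 156 * cc + cbs + ccs) * U ≤ 1)
    -- the (P)-receiver's other inputs at the last index (k3c3-p1 `twoLegRead_flow_succ_of_swap_lit_registered`, n := n_β)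
    (hLdeg : 4 * klFlowDeg (nScales β + 1) ≤ L) {cA cA' pc pc' : ℕ → ℝ} {τA a : ℝ} (hpc : ∀ k, 0 ≤ pc k) (hpc' : ∀ k, 0 ≤ pc' k)
    (hA : TwoLegCurveJetBound L M cA cA' β U μ (klFlowFrameU L M β U μ (nScales β)) (nScales β + 1))
    (hAval : ∀ θ : ℝ, |klTwoLegCurveProfile L M β U μ (klFlowFrameU L M β U μ (nScales β)) (nScales β + 1) θ - τA| ≤
      a * U ^ 2 * (4 : ℝ) ^ (-2 * ((nScales β + 1 : ℕ) : ℤ)))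
    -- (T): the #17 export at the LAST index `(K_{n_β+1}, n_β+1)`, five rows (factor `4^{j−1}`), a primed table above `transport_jets_flow_fit`'s
    {z : ℕ → ℝ} (hz : ∀ j, 0 ≤ z j) (hZsp : TwoLegDualSpaceMomentsUpToAt L M (klZspLaw z U (nScales β + 1)) β U μ (nScales β + 1) 5)
    {mT : ℕ → ℝ} (hmT : ∀ j, 0 ≤ mT j)
    (hmT1 : 4 / 3 * R.Gfr 1 + 2 * z 1 ≤ mT 1) (hmT2 : R.Gfr 2 + 8 * z 2 ≤ mT 2) (hmT3 : R.Gfr 3 / 3 + 32 * z 3 ≤ mT 3)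
    (hmT4 : R.Gfr 4 / 15 + 128 * z 4 ≤ mT 4) (hmT5 : 2 ^ 5 * (Real.pi ^ 8 / 4 * 2 ^ 4 * (2 : ℝ) ^ 32) * W / 63 + 512 * z 5 ≤ mT 5)
    {eT' : ℕ → ℝ} (heT : ∀ k ≤ 4,
        (fun k : ℕ =>
          if k = 0 then 16 * ((12.2 * R.Gfr 0 * mT 1))
          else if k = 1 then 4 * ((1420 * 2 * (R.Gfr 1 + R.Gfr 2 + R.Gfr 3 + R.Gfr 4) * 2 * mT 1) + (36400 * R.Gfr 0 * mT 1) + (2820 * R.Gfr 0 * mT 2))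
          else if k = 2 then ((12900000 * 2 ^ 2 * (R.Gfr 1 + R.Gfr 2 + R.Gfr 3 + R.Gfr 4) * 2 ^ 2 * mT 1) + (657000 * 2 * (R.Gfr 1 + R.Gfr 2 + R.Gfr 3 + R.Gfr 4) * 2 * mT 2) + (338000000 * 2 * R.Gfr 0 * 2 * mT 1) + (25400000 * R.Gfr 0 * mT 2) + (652000 * R.Gfr 0 * mT 3))
          else if k = 3 then ((199000000000 * 2 ^ 3 * (R.Gfr 1 + R.Gfr 2 + R.Gfr 3 + R.Gfr 4) * 2 ^ 3 * mT 1) + (12000000000 * 2 ^ 2 * (R.Gfr 1 + R.Gfr 2 + R.Gfr 3 + R.Gfr 4) * 2 ^ 2 * mT 2) + (228000000 * 2 * (R.Gfr 1 + R.Gfr 2 + R.Gfr 3 + R.Gfr 4) * 2 * mT 3) + (5230000000000 * 2 ^ 2 * R.Gfr 0 * 2 ^ 2 * mT 1) + (392000000000 * 2 * R.Gfr 0 * 2 * mT 2) + (11800000000 * R.Gfr 0 * mT 3) + (151000000 * R.Gfr 0 * mT 4)) / 4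
          else if k = 4 then ((4300000000000000 * 2 ^ 4 * (R.Gfr 1 + R.Gfr 2 + R.Gfr 3 + R.Gfr 4) * 2 ^ 4 * mT 1) + (276000000000000 * 2 ^ 3 * (R.Gfr 1 + R.Gfr 2 + R.Gfr 3 + R.Gfr 4) * 2 ^ 3 * mT 2) + (6890000000000 * 2 ^ 2 * (R.Gfr 1 + R.Gfr 2 + R.Gfr 3 + R.Gfr 4) * 2 ^ 2 * mT 3) + (70100000000 * 2 * (R.Gfr 1 + R.Gfr 2 + R.Gfr 3 + R.Gfr 4) * 2 * mT 4) + (114000000000000000 * 2 ^ 2 * R.Gfr 0 * 2 ^ 2 * mT 1) + (8490000000000000 * 2 ^ 2 * R.Gfr 0 * 2 ^ 2 * mT 2) + (272000000000000 * 2 * R.Gfr 0 * 2 * mT 3) + (4530000000000 * R.Gfr 0 * mT 4) + (34800000000 * R.Gfr 0 * mT 5) + (69200000000 * (16 / 15) * R.Gfr 4 * mT 1)) / 16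
          else 0) k ≤ eT' k)
    -- (C1): the window certificate of the analytic branch and the PRIVATE induction hypothesis (jets half) at scale n_β
    (hcertA : KlwjCertA) (hIH : TwoLegReadJetBound L M pc pc' β U μ (klFlowFrameU L M β U μ (nScales β)) (nScales β))
    (hfit : ∀ k, cA k + ((if k = 0 then (0 : ℝ) else 1) + klC1AnFit pc k) ≤ klC4aJetC2 k)
    (hfit' : ∀ k, cA' k + ((if k = 0 then (1 : ℝ) else 0) + eT' k + klC1AnFit' pc pc' k) ≤ klC4aJetC' P R k)
    (hfitO : 2 * (a + (1 + eT' 0 + klC1AnFit' pc pc' 0)) ≤ klReadOscC P R) :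
    TwoLegReadJetBound L M klC4aJetC2 (klC4aJetC' P R) β U μ (klFlowFrameU L M β U μ (nScales β + 1)) (nScales β + 1) ∧
      TwoLegReadOscAt L M (klReadOscC P R) β U μ (klFlowFrameU L M β U μ (nScales β + 1)) (nScales β + 1) := by
  have hR : ∀ j, 0 ≤ R.Gfr j := hRW.2.2
  have hcle : c ≤ klCurveC3 R := hc6.trans ((klEngC₃6_le_klEngC₃3 P R).trans (klEngC₃3_le_klCurveC3 P hR))
  have hUle : U ≤ klCurveU0 R := hU9.trans ((klEngU₀9_le_klEngU₀3 P R c).trans (klEngU₀3_le_klCurveU0 P hR c))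
  have hU1 : U ≤ 1 := hUle.trans (klCurveU0_le_one R)
  have hreg : IsKLRegime U c (-((nScales β + 1 : ℕ) : ℤ)) := isKLRegime_of_le_nScales_succ hc.le hβmin hβc le_rfl
  obtain ⟨hJdiff, hJ⟩ := readResidueC1_hJ_analytic_klEng (L := L) (M := M) hcertA hRW hc hc6 hμ hU hU9 hβmin hβc hN5 hreg hK1
    (fun m hm => hPh m (by omega)) hpc hpc' hIH
  have hG34U : 2 * (R.Gfr 3 + R.Gfr 4) * U ^ 2 ≤ 1 := by
    have hU4 : U ≤ klEngU₀4 P R c := hU9.trans (klEngU₀9_le_klEngU₀4 P R c)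
    have h3 := gfr_mul_le_of_le_klEngU₀4 (P := P) hRW hU4 (show 3 < 5 by norm_num)
    have h4 := gfr_mul_le_of_le_klEngU₀4 (P := P) hRW hU4 (show 4 < 5 by norm_num)
    have hG3 := hR 3
    have hG4 := hR 4
    have hs : R.Gfr 3 * U + R.Gfr 4 * U ≤ 1 / 2 ^ 127 + 1 / 2 ^ 127 := add_le_add h3 h4
    have e : 2 * (R.Gfr 3 + R.Gfr 4) * U ^ 2 = 2 * U * (R.Gfr 3 * U + R.Gfr 4 * U) := by ring
    rw [e]
    calc 2 * U * (R.Gfr 3 * U + R.Gfr 4 * U) ≤ 2 * 1 * (1 / 2 ^ 127 + 1 / 2 ^ 127) := by gcongr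
      _ ≤ 1 := by norm_num
  exact twoLegRead_flow_last_registered_of_pos_c2_l2 hR hc hcle hU hU1 hUle hG34U hβmin hβc hμ hK hK1 hGS hQS hR0 hPh hT hW hΞ hΘ hdoor hL hZn hs hcb hcbs hcc
    hccs hSb hSbs hTc hTcs hUlast hUE1 hLdeg hA hAval hz hZsp hmT hmT1 hmT2 hmT3 hmT4 hmT5 heT hJdiff hJ (klC1AnFit_zero pc) hfit hfit' hfitO

/-- **«LAST-ALL-DOORS», table** (`n_β + 1 ≤ 21`): the same (L2 table) with (C1) := k3c3-p1's table branch at a cutoff-defect certificate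
`CutoffDefectCertFrame (klFlowDeg n_β) A T` (`A ≥ 10⁻¹²`), read below any tables `eJ, eJ′` dominating its linear forms at `k ≤ 4` (`eJ 0 = 0`).
[cite: BenfattoGiulianiMastropietro2006, §2.4 Lemma 2.1 (2.36)–(2.42)] -/
theorem twoLegRead_flow_last_registered_table_l2 {P : SplitConsts} {R : RenConsts} (hRW : R.WF) {c : ℝ} (hc : 0 < c) (hc6 : c ≤ klEngC₃6 P R)
    {U : ℝ} (hU : 0 < U) (hU9 : U ≤ klEngU₀9 P R c) {β : ℝ} (hβmin : klBetaMin ≤ β) (hβc : β ≤ Real.exp (c / U ^ 2)) (hN21 : nScales β + 1 ≤ 21)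
    {μ : ℝ} (hμ : μ ∈ klWindowC) (hK : FrameOK R U (nScales β) μ (klFlowFrameU L M β U μ (nScales β)))
    (hK1 : FrameOK R U (nScales β) μ (klFlowFrameU L M β U μ (nScales β + 1))) {G : GeoConsts} {Q : EngConsts} (hGS : ∀ k, 0 ≤ G.S k) (hQS : ∀ k, 0 ≤ Q.S' k) (hR0 : 0 < R.Gfr 0)
    (hPh : ∀ m ≤ nScales β, FlowPieceJetsAt L M β U μ R m) (hT : ∀ m ≤ nScales β, TwoLegReadJetsF L M G Q β U μ m) {W Ξ Θ : ℝ}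
    (hW : W = curveExtC (klChi2CauchyTab2 4) G.S 1 + curveExtC (klChi2CauchyTab2 4) Q.S' 1 * |U|) (hΞ : Ξ = 2 ^ 10 * (1 + Real.pi ^ 8 * (W * U ^ 2) / 2 ^ 11) + ∑ j ∈ range 5, R.Gfr j)
    (hΘ : Θ = 1 + ((∑ j ∈ range 5, R.Gfr j) + Real.pi ^ 8 * W / 2 ^ 11) * |U| / R.Gfr 0)
    (hdoor : R.Gfr 0 * |U| + ((∑ j ∈ range 5, R.Gfr j) + Real.pi ^ 8 * W / 2 ^ 11) * U ^ 2 ≤ 1 / 512) (hL : klEngL₄ P R β U ≤ L)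
    (hZn : IsUnit (effPartitionFn ℂ (normalCovariance L M (uvSymbolCT L M β μ (klFlowFrameU L M β U μ (nScales β + 1)) (klScale klE0 (nScales β + 1))))
      (hubbardInteraction L M β U + counterQuadratic L M β (klFlowFrameU L M β U μ (nScales β + 1)))))
    {s : ℕ} (hs : 10 ≤ s)
    {cb cbs cc ccs : ℝ} (hcb : 0 ≤ cb) (hcbs : 0 ≤ cbs) (hcc : 0 ≤ cc) (hccs : 0 ≤ ccs)
    (hSb : ∀ m ≤ 4, ∀ (σ : Fin 2) (x₀ : SpaceTimeIdx L M), imagTimeWeight β M *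
      ∑ x ∈ (univ : Finset (Fin 2 → SpaceTimeIdx L M)).filter (fun x => x 0 = x₀),
        (1 + ((((x 1).2 - (x 0).2) 0).valMinAbs.natAbs : ℝ) + ((((x 1).2 - (x 0).2) 1).valMinAbs.natAbs : ℝ)) ^ m *
          ‖sectorisedKernel L M β (trivialMultiplier L M) (klEffectiveAction L M β U μ (klFlowFrameU L M β U μ (nScales β + 1)) klE0 (nScales β + 1)) 2
            (![((0, σ), 0), ((0, σ), 1)] : Fin 2 → SectorLeg 1) x‖ ≤ cb * U * ((4 : ℝ) ^ nScales β) ^ m)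
    (hSbs : ∀ (σ : Fin 2) (x₀ : SpaceTimeIdx L M), imagTimeWeight β M *
      ∑ x ∈ (univ : Finset (Fin 2 → SpaceTimeIdx L M)).filter (fun x => x 0 = x₀),
        (1 + ((((x 1).2 - (x 0).2) 0).valMinAbs.natAbs : ℝ) + ((((x 1).2 - (x 0).2) 1).valMinAbs.natAbs : ℝ)) ^ s *
          ‖sectorisedKernel L M β (trivialMultiplier L M) (klEffectiveAction L M β U μ (klFlowFrameU L M β U μ (nScales β + 1)) klE0 (nScales β + 1)) 2
            (![((0, σ), 0), ((0, σ), 1)] : Fin 2 → SectorLeg 1) x‖ ≤ cbs * U * ((4 : ℝ) ^ nScales β) ^ s)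
    (hTc : ∀ m ≤ 4, ∀ (σ : Fin 2) (x₀ : SpaceTimeIdx L M), imagTimeWeight β M *
      ∑ x ∈ (univ : Finset (Fin 2 → SpaceTimeIdx L M)).filter (fun x => x 0 = x₀),
        (1 + ((((x 1).2 - (x 0).2) 0).valMinAbs.natAbs : ℝ) + ((((x 1).2 - (x 0).2) 1).valMinAbs.natAbs : ℝ)) ^ m * (imagTimeWeight β M * (circDist (2 * M) (x 0).1.val (x 1).1.val : ℝ)) *
          ‖sectorisedKernel L M β (trivialMultiplier L M) (klEffectiveAction L M β U μ (klFlowFrameU L M β U μ (nScales β + 1)) klE0 (nScales β + 1)) 2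
            (![((0, σ), 0), ((0, σ), 1)] : Fin 2 → SectorLeg 1) x‖ ≤ cc * U ^ 2 * ((4 : ℝ) ^ nScales β) ^ m)
    (hTcs : ∀ (σ : Fin 2) (x₀ : SpaceTimeIdx L M), imagTimeWeight β M *
      ∑ x ∈ (univ : Finset (Fin 2 → SpaceTimeIdx L M)).filter (fun x => x 0 = x₀),
        (1 + ((((x 1).2 - (x 0).2) 0).valMinAbs.natAbs : ℝ) + ((((x 1).2 - (x 0).2) 1).valMinAbs.natAbs : ℝ)) ^ s * (imagTimeWeight β M * (circDist (2 * M) (x 0).1.val (x 1).1.val : ℝ)) *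
          ‖sectorisedKernel L M β (trivialMultiplier L M) (klEffectiveAction L M β U μ (klFlowFrameU L M β U μ (nScales β + 1)) klE0 (nScales β + 1)) 2
            (![((0, σ), 0), ((0, σ), 1)] : Fin 2 → SectorLeg 1) x‖ ≤ ccs * U ^ 2 * ((4 : ℝ) ^ nScales β) ^ s)
    (hUlast : U ≤ klLastRespU P R) (hUE1 : 32 * klEngRsq R ^ 5 * (2 ^ 234 * cb + 2 ^ 156 * cc + cbs + ccs) * U ≤ 1)
    -- the (P)-receiver's other inputs at the last index (k3c3-p1 `twoLegRead_flow_succ_of_swap_lit_registered`, n := n_β)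
    (hLdeg : 4 * klFlowDeg (nScales β + 1) ≤ L) {cA cA' pc pc' : ℕ → ℝ} {τA a : ℝ} (hpc : ∀ k, 0 ≤ pc k) (hpc' : ∀ k, 0 ≤ pc' k)
    (hA : TwoLegCurveJetBound L M cA cA' β U μ (klFlowFrameU L M β U μ (nScales β)) (nScales β + 1))
    (hAval : ∀ θ : ℝ, |klTwoLegCurveProfile L M β U μ (klFlowFrameU L M β U μ (nScales β)) (nScales β + 1) θ - τA| ≤
      a * U ^ 2 * (4 : ℝ) ^ (-2 * ((nScales β + 1 : ℕ) : ℤ)))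
    -- (T): the #17 export at the LAST index `(K_{n_β+1}, n_β+1)`, five rows (factor `4^{j−1}`), a primed table above `transport_jets_flow_fit`'s
    {z : ℕ → ℝ} (hz : ∀ j, 0 ≤ z j) (hZsp : TwoLegDualSpaceMomentsUpToAt L M (klZspLaw z U (nScales β + 1)) β U μ (nScales β + 1) 5)
    {mT : ℕ → ℝ} (hmT : ∀ j, 0 ≤ mT j)
    (hmT1 : 4 / 3 * R.Gfr 1 + 2 * z 1 ≤ mT 1) (hmT2 : R.Gfr 2 + 8 * z 2 ≤ mT 2) (hmT3 : R.Gfr 3 / 3 + 32 * z 3 ≤ mT 3)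
    (hmT4 : R.Gfr 4 / 15 + 128 * z 4 ≤ mT 4) (hmT5 : 2 ^ 5 * (Real.pi ^ 8 / 4 * 2 ^ 4 * (2 : ℝ) ^ 32) * W / 63 + 512 * z 5 ≤ mT 5)
    {eT' : ℕ → ℝ} (heT : ∀ k ≤ 4,
        (fun k : ℕ =>
          if k = 0 then 16 * ((12.2 * R.Gfr 0 * mT 1))
          else if k = 1 then 4 * ((1420 * 2 * (R.Gfr 1 + R.Gfr 2 + R.Gfr 3 + R.Gfr 4) * 2 * mT 1) + (36400 * R.Gfr 0 * mT 1) + (2820 * R.Gfr 0 * mT 2))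
          else if k = 2 then ((12900000 * 2 ^ 2 * (R.Gfr 1 + R.Gfr 2 + R.Gfr 3 + R.Gfr 4) * 2 ^ 2 * mT 1) + (657000 * 2 * (R.Gfr 1 + R.Gfr 2 + R.Gfr 3 + R.Gfr 4) * 2 * mT 2) + (338000000 * 2 * R.Gfr 0 * 2 * mT 1) + (25400000 * R.Gfr 0 * mT 2) + (652000 * R.Gfr 0 * mT 3))
          else if k = 3 then ((199000000000 * 2 ^ 3 * (R.Gfr 1 + R.Gfr 2 + R.Gfr 3 + R.Gfr 4) * 2 ^ 3 * mT 1) + (12000000000 * 2 ^ 2 * (R.Gfr 1 + R.Gfr 2 + R.Gfr 3 + R.Gfr 4) * 2 ^ 2 * mT 2) + (228000000 * 2 * (R.Gfr 1 + R.Gfr 2 + R.Gfr 3 + R.Gfr 4) * 2 * mT 3) + (5230000000000 * 2 ^ 2 * R.Gfr 0 * 2 ^ 2 * mT 1) + (392000000000 * 2 * R.Gfr 0 * 2 * mT 2) + (11800000000 * R.Gfr 0 * mT 3) + (151000000 * R.Gfr 0 * mT 4)) / 4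
          else if k = 4 then ((4300000000000000 * 2 ^ 4 * (R.Gfr 1 + R.Gfr 2 + R.Gfr 3 + R.Gfr 4) * 2 ^ 4 * mT 1) + (276000000000000 * 2 ^ 3 * (R.Gfr 1 + R.Gfr 2 + R.Gfr 3 + R.Gfr 4) * 2 ^ 3 * mT 2) + (6890000000000 * 2 ^ 2 * (R.Gfr 1 + R.Gfr 2 + R.Gfr 3 + R.Gfr 4) * 2 ^ 2 * mT 3) + (70100000000 * 2 * (R.Gfr 1 + R.Gfr 2 + R.Gfr 3 + R.Gfr 4) * 2 * mT 4) + (114000000000000000 * 2 ^ 2 * R.Gfr 0 * 2 ^ 2 * mT 1) + (8490000000000000 * 2 ^ 2 * R.Gfr 0 * 2 ^ 2 * mT 2) + (272000000000000 * 2 * R.Gfr 0 * 2 * mT 3) + (4530000000000 * R.Gfr 0 * mT 4) + (34800000000 * R.Gfr 0 * mT 5) + (69200000000 * (16 / 15) * R.Gfr 4 * mT 1)) / 16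
          else 0) k ≤ eT' k)
    -- (C1): the cutoff-defect certificate of the table branch at degree `klFlowDeg n_β`, the PRIVATE induction hypothesis (jets half), tables above
    {d : ℕ} (hd : klFlowDeg (nScales β) = d) {A : ℕ → ℝ} {T : CutoffDefectTable} (hcert : CutoffDefectCertFrame d A T) (hTd : 0 ≤ T.Td)
    (hN0 : 0 ≤ T.N0) (hA12 : ∀ j ≤ 4, (1 : ℝ) / 10 ^ 12 ≤ A j) (hIH : TwoLegReadJetBound L M pc pc' β U μ (klFlowFrameU L M β U μ (nScales β)) (nScales β))
    {eJ eJ' : ℕ → ℝ} (heJ0 : eJ 0 = 0)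
    (heJ : ∀ k ≤ 4,
        (fun k => if k = 0 then 0 else
          (if k ≤ 3 then T.bound (fun l : ℕ => if l = 0 then π / 2 * pc 1 * (4 : ℝ) ^ ((((1 : ℕ) : ℤ) - 2) * (nScales β)) else pc l * (4 : ℝ) ^ (((l : ℤ) - 2) * (nScales β))) k
            else T.boundNR (fun l : ℕ => if l = 0 then π / 2 * pc 1 * (4 : ℝ) ^ ((((1 : ℕ) : ℤ) - 2) * (nScales β)) else pc l * (4 : ℝ) ^ (((l : ℤ) - 2) * (nScales β))) k) *
            ((4 : ℝ) ^ (((k : ℤ) - 2) * (((nScales β) + 1 : ℕ) : ℤ)))⁻¹) k ≤ eJ k)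
    (heJ' : ∀ k ≤ 4,
        (fun k => if k = 0 then (pc 1 + pc' 1) * (T.Td + π / 2 * T.N0) * (4 : ℝ) ^ ((((1 : ℕ) : ℤ) - 2) * (nScales β)) *
            ((4 : ℝ) ^ ((((0 : ℕ) : ℤ) - 2) * (((nScales β) + 1 : ℕ) : ℤ)))⁻¹ else
          (if k ≤ 3 then T.bound (fun l : ℕ => if l = 0 then π / 2 * pc' 1 * (4 : ℝ) ^ ((((1 : ℕ) : ℤ) - 2) * (nScales β)) else pc' l * (4 : ℝ) ^ (((l : ℤ) - 2) * (nScales β))) k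
            else T.boundNR (fun l : ℕ => if l = 0 then π / 2 * pc' 1 * (4 : ℝ) ^ ((((1 : ℕ) : ℤ) - 2) * (nScales β)) else pc' l * (4 : ℝ) ^ (((l : ℤ) - 2) * (nScales β))) k) *
            ((4 : ℝ) ^ (((k : ℤ) - 2) * (((nScales β) + 1 : ℕ) : ℤ)))⁻¹) k ≤ eJ' k)
    (hfit : ∀ k, cA k + ((if k = 0 then (0 : ℝ) else 1) + eJ k) ≤ klC4aJetC2 k)
    (hfit' : ∀ k, cA' k + ((if k = 0 then (1 : ℝ) else 0) + eT' k + eJ' k) ≤ klC4aJetC' P R k)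
    (hfitO : 2 * (a + (1 + eT' 0 + eJ' 0)) ≤ klReadOscC P R) :
    TwoLegReadJetBound L M klC4aJetC2 (klC4aJetC' P R) β U μ (klFlowFrameU L M β U μ (nScales β + 1)) (nScales β + 1) ∧
      TwoLegReadOscAt L M (klReadOscC P R) β U μ (klFlowFrameU L M β U μ (nScales β + 1)) (nScales β + 1) := by
  have hR : ∀ j, 0 ≤ R.Gfr j := hRW.2.2
  have hcle : c ≤ klCurveC3 R := hc6.trans ((klEngC₃6_le_klEngC₃3 P R).trans (klEngC₃3_le_klCurveC3 P hR))
  have hUle : U ≤ klCurveU0 R := hU9.trans ((klEngU₀9_le_klEngU₀3 P R c).trans (klEngU₀3_le_klCurveU0 P hR c))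
  have hU1 : U ≤ 1 := hUle.trans (klCurveU0_le_one R)
  obtain ⟨hJdiff, hJ0⟩ := readResidueC1_hJ_of_twoLegReadJetBound_klEng (L := L) (M := M) hRW hc hc6 hμ hU hU9 hβmin hβc hN21 hK1
    (fun m hm => hPh m (by omega)) hd hcert hTd hN0 hA12 hpc hpc' hIH
  have hJ : ∀ k ≤ 4, ∀ θ : ℝ, |iteratedDeriv k (fun θ : ℝ => klLocalPart L M β U μ (klFlowFrameU L M β U μ (nScales β)) (nScales β) θ -
      (klFlowPiece L M β U μ (nScales β)).eval (klFermiPoint μ (klFlowFrameU L M β U μ (nScales β + 1)) θ)) θ| ≤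
      curveJetBar eJ eJ' U k (nScales β + 1) :=
    fun k hk θ => (hJ0 k hk θ).trans (curveJetBar_mono_at (heJ k hk) (heJ' k hk))
  have hG34U : 2 * (R.Gfr 3 + R.Gfr 4) * U ^ 2 ≤ 1 := by
    have hU4 : U ≤ klEngU₀4 P R c := hU9.trans (klEngU₀9_le_klEngU₀4 P R c)
    have h3 := gfr_mul_le_of_le_klEngU₀4 (P := P) hRW hU4 (show 3 < 5 by norm_num)
    have h4 := gfr_mul_le_of_le_klEngU₀4 (P := P) hRW hU4 (show 4 < 5 by norm_num)
    have hG3 := hR 3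
    have hG4 := hR 4
    have hs : R.Gfr 3 * U + R.Gfr 4 * U ≤ 1 / 2 ^ 127 + 1 / 2 ^ 127 := add_le_add h3 h4
    have e : 2 * (R.Gfr 3 + R.Gfr 4) * U ^ 2 = 2 * U * (R.Gfr 3 * U + R.Gfr 4 * U) := by ring
    rw [e]
    calc 2 * U * (R.Gfr 3 * U + R.Gfr 4 * U) ≤ 2 * 1 * (1 / 2 ^ 127 + 1 / 2 ^ 127) := by gcongr
      _ ≤ 1 := by norm_num
  exact twoLegRead_flow_last_registered_of_pos_c2_l2 hR hc hcle hU hU1 hUle hG34U hβmin hβc hμ hK hK1 hGS hQS hR0 hPh hT hW hΞ hΘ hdoor hL hZn hs hcb hcbs hcc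
    hccs hSb hSbs hTc hTcs hUlast hUE1 hLdeg hA hAval hz hZsp hmT hmT1 hmT2 hmT3 hmT4 hmT5 heT hJdiff hJ heJ0 hfit hfit' hfitO

end Summit.HubbardSuperconductivity.HubbardSuperconductivity.Theorems.EngineV8

end
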